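import Summits.ResolutionOfSingularities.ResolutionOfSingularities.Theorems.StallVertexClasses
import Summits.ResolutionOfSingularities.ResolutionOfSingularities.Theorems.StallVertexLines
import HarnessLib

/-!
# StallVertexRigidClasses — decomp-res node «StallVertex» (lens-5 g20 rev 2), tree file 8/9 of the node

Content VERBATIM from the decomp-res lens-5 g20 file
`HOME/decomp-res-lens-5/g20/parts/StallVertex-g20-rev2-d6168cb0.lean` (1724 l; rev 2, which SUPERSEDES
the pins 0349e14d (869 l) and rev 1 d60a69dd with all earlier statements byte-identical; HOME =
run/shared/lean/pub/decomp-res).  The rev-0 sections §1/§2/§3/§4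
are ALREADY in the tree from pin 0349e14d as `StallVertexForms` / `StallVertexKernels` / `StallVertexWalk` /
`StallVertexClasses`; this file carries ONLY
declarations NEW in rev 1 / rev 2.  Critic: CRITIC-LEDGER rows 142 (CLEARED 20:41:19Z: the stall vertex law), 142a
(21:01:24Z: rev 1 stall rigidity), 142b
(21:17:44Z: rev 2 contact-line law; ONE located-residual aside = `StallVertex.NoLineFreeRigidSkewStalledTailsDeep`,
the sharpest exact form, chain
skew ↔ vertexBound ↔ rigid ↔ lineFree hypothesis-free, superseding `CoefficientCut.NoSkewJointTailsDeep`).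
Landed by decomp-res writer g7.  Every file of the
node is in the Theses cone (the lens imports the in-cone `DifferentialShade`), so the residual is booked on the
route by RE-LOCATING the existing aside 28122
`CFNoSkewJointTailsDeep` (EXACTLY ⟺ it) — one aside, not two.

§4 additions of rev 1 / rev 2 (`section Classes`): the RIGID located residual `NoRigidSkewStalledTailsDeep` with
`rigid_of_vertexBound` / `vertexBound_of_rigid` /
EXACT `vertexBound_iff_rigid` / `skew_iff_rigid`; the contact-line cell `NoContactLineSkewTailsDeep` DECIDED in
kernel (`false_of_skew_of_planar`,
`noContactLineSkewTailsDeep_holds`, `contactLineSkew_of_skew`); **THE LOCATED RESIDUAL OF THE NODE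
`NoLineFreeRigidSkewStalledTailsDeep`** with `lineFree_of_rigid` /
`rigid_of_lineFree` / EXACT `rigid_iff_lineFree` / `skew_iff_lineFree : CoefficientCut.NoSkewJointTailsDeep ↔
NoLineFreeRigidSkewStalledTailsDeep` (hypothesis-free).
Imports the landed `StallVertexClasses` (pin-0349e14d §4: `NoVertexBoundSkewStalledTailsDeep`,
`skew_iff_vertexBound`, the split) and `StallVertexLines`.

[WRITER NOTE (decomp-res writer g7): file split only; namespace, opens, section variables and every declaration
exactly as in the lens (global `set_option` dropped; the lens's `set_option maxHeartbeats … in` on `stall_rigid` kept).]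

(Sources: KawanoueMatsuki2016 Prop. 4 (2), §4.1; Hauser2010; HauserPerlega2024; Moh1987; CossartPiltant2008;
Giraud1975; Hironaka1964; ZariskiSamuelII Ch. VIII §2.)
-/

noncomputable section

open MvPolynomial Finset
open Literature.AlgebraicGeometry.Resolution
open Literature.AlgebraicGeometry.Resolution.Hauser2010
open Literature.AlgebraicGeometry.Resolution.HauserPerlega2024
open Literature.Barriers.ResolutionOfSingularities
open Literature.AlgebraicGeometry.Resolution.PointBlowup
open Summit.ResolutionOfSingularities.ResolutionOfSingularities.Theses
open Summit.ResolutionOfSingularities.ResolutionOfSingularities.Theorems.TightDefectClasses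
open Summit.ResolutionOfSingularities.ResolutionOfSingularities.Theorems.ProximityCut
open Summit.ResolutionOfSingularities.ResolutionOfSingularities.Theorems.ExitLaw
open Summit.ResolutionOfSingularities.ResolutionOfSingularities.Theorems.DifferentialShade

namespace Summit.ResolutionOfSingularities.ResolutionOfSingularities.Theorems.StallVertex

section Classes

/-- **THE RIGID LOCATED RESIDUAL (EXACT SHARPENING OF THE BINDER):** the same class with the vertex law IN FORCE WITH
EQUALITY (`VertexLawEqAt`: exact vertex order, layer bound attained, minimisers persist,
`μ_P(t+1) = 2μ_P(t) − 1 − lostMass(t)`, `μ_{P,D_j}(t+1) = μ_P(t) − 1`) at every late move.  EXACT: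
`NoVertexBoundSkewStalledTailsDeep ↔` this (`vertexBound_iff_rigid`, hypothesis-free by `vertexLawEqAt_of_stall`). [new] -/
def NoRigidSkewStalledTailsDeep : Prop :=
  ∀ p : ℕ, p.Prime → ∀ e : ℕ, 2 ≤ e → ∀ (K : Type) [Field K] [CharP K p] [PerfectField K] [DecidableEq K]
    (s₀ : State (Fin 3) K), IsRoot (p ^ e) s₀ → ∀ W : ForcedWalk (p ^ e) s₀, (∀ i, 1 ≤ (W.st i).shade) →
    ∀ N : ℕ, (∀ t, N ≤ t → (W.st (t + 1)).shade = (W.st t).shade) →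
    (∀ t, N ≤ t → ordZero (W.st t).F ≠ ((p ^ e : ℕ) : ℕ∞)) →
    (∀ M : ℕ, ∃ t, M ≤ t ∧ StaysOnNewest W t) → (∀ M : ℕ, ∃ t, M ≤ t ∧ W.b t ≠ 0) →
    (∀ (k : Fin 3) (N' : ℕ), ∃ t, N' ≤ t ∧ (W.j t = k ∨ W.b t k ≠ 0)) →
    (∀ t, N ≤ t → (ifp W (t + 1)).muTilde (p ^ e) = (ifp W t).muTilde (p ^ e)) →
    (∀ t, N ≤ t → VertexLawEqAt W t) → (∀ t, N ≤ t → OriginLawAt W t) → False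

/-- Trivial direction: rigid tails are vertex-bound tails. [folklore] -/
theorem rigid_of_vertexBound (h : NoVertexBoundSkewStalledTailsDeep) : NoRigidSkewStalledTailsDeep :=
  fun p hp e he K _ _ _ _ s₀ hs W hsh N hplat hexc hS hT hskew hstall hrig horig =>
    h p hp e he K s₀ hs W hsh N hplat hexc hS hT hskew hstall
      (fun t ht => vertexLawAt_of_vertexLawEqAt W t (hrig t ht)) horig

/-- **Hypothesis-free direction:** a vertex-bound skew stalled tail IS rigid (`vertexLawEqAt_of_stall`). [folklore] -/
theorem vertexBound_of_rigid (h : NoRigidSkewStalledTailsDeep) : NoVertexBoundSkewStalledTailsDeep :=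
  fun p hp e he K _ _ _ _ s₀ hs W hsh N hplat hexc hS hT hskew hstall _ horig =>
    h p hp e he K s₀ hs W hsh N hplat hexc hS hT hskew hstall
      (fun t ht => vertexLawEqAt_of_stall hp hs W t (hstall t ht).ge) horig

/-- **EXACT SHARPENING of the located residual's binder (stall rigidity in kernel).** [folklore] -/
theorem vertexBound_iff_rigid : NoVertexBoundSkewStalledTailsDeep ↔ NoRigidSkewStalledTailsDeep :=
  ⟨rigid_of_vertexBound, vertexBound_of_rigid⟩

/-- The skew residual of g19, re-located to the RIGID class (EXACT, hypothesis-free). [folklore] -/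
theorem skew_iff_rigid : CoefficientCut.NoSkewJointTailsDeep ↔ NoRigidSkewStalledTailsDeep :=
  skew_iff_vertexBound.trans vertexBound_iff_rigid

/-- DECIDED CLASS (rev 2) · **SKEW TAILS CARRYING A CONTACT LINE** · the skew class's binders VERBATIM
(`CoefficientCut.NoSkewJointTailsDeep`: joint binders + «every coordinate is charted-or-translated infinitely often»)
+ «from some time `s` on a non-zero linear functional `c` is a CONTACT LINE» (`ContactLineFrom W s c`: the carried
line — chart coefficient zeroed at each move — contains the direction of every move; a predicate on the letters
`(j_t, b_t)` only).  PROVED EMPTY (`noContactLineSkewTailsDeep_holds`): one proximity repeat after `s` collapses the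
carried line to a coordinate `u_m` (`planar_of_contactLine`) and the skew binder at `k = m` is violated.  FINITELY
ENTERED: every translated stalled move of the census (68, of which 57 frame monomials) and every stalled chart change
(34, all pure-power cones) is a move whose direction lies on the stripped cone's line — the g21 law (clean transport
⇒ the line is CARRIED, NEXT-g21 §1 item 2) is what promotes such events to `ContactLineFrom`.  This is the «constant
frame» half of the critic's window (i): A CONSTANT FRAME CONTRADICTS SKEWNESS. [new] -/
def NoContactLineSkewTailsDeep : Prop :=
  ∀ p : ℕ, p.Prime → ∀ e : ℕ, 2 ≤ e → ∀ (K : Type) [Field K] [CharP K p] [PerfectField K] [DecidableEq K]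
    (s₀ : State (Fin 3) K), IsRoot (p ^ e) s₀ → ∀ W : ForcedWalk (p ^ e) s₀, (∀ i, 1 ≤ (W.st i).shade) →
    ∀ N : ℕ, (∀ t, N ≤ t → (W.st (t + 1)).shade = (W.st t).shade) →
    (∀ t, N ≤ t → ordZero (W.st t).F ≠ ((p ^ e : ℕ) : ℕ∞)) →
    (∀ M : ℕ, ∃ t, M ≤ t ∧ StaysOnNewest W t) → (∀ M : ℕ, ∃ t, M ≤ t ∧ W.b t ≠ 0) →
    (∀ (k : Fin 3) (N' : ℕ), ∃ t, N' ≤ t ∧ (W.j t = k ∨ W.b t k ≠ 0)) →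
    ∀ (s : ℕ) (c : Fin 3 → K), ContactLineFrom W s c → False

/-- The skew letter and a planar tail are incompatible. [folklore] -/
theorem false_of_skew_of_planar {K : Type} [Field K] [DecidableEq K] {q : ℕ} {s₀ : State (Fin 3) K}
    (W : ForcedWalk q s₀)
    (hskew : ∀ (k : Fin 3) (N' : ℕ), ∃ t, N' ≤ t ∧ (W.j t = k ∨ W.b t k ≠ 0))
    (hpl : ∃ (k : Fin 3) (N' : ℕ), ∀ t, N' ≤ t → W.j t ≠ k ∧ W.b t k = 0) : False := by
  obtain ⟨k, N', h⟩ := hpl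
  obtain ⟨t, ht, hj | hb⟩ := hskew k N'
  · exact (h t ht).1 hj
  · exact hb (h t ht).2

/-- **THE CONTACT-LINE CELL IS EMPTY** (kernel, letters only, every `q`, every field). [folklore] -/
theorem noContactLineSkewTailsDeep_holds : NoContactLineSkewTailsDeep :=
  fun _ _ _ _ _ _ _ _ _ _ _ W _ _ _ _ hS _ hskew _ _ hc =>
    false_of_skew_of_planar W hskew (planar_of_contactLine_of_repeats W hc hS)

/-- The decided cell is a sub-class of the g19 skew residual BY LETTER (binders added). [folklore] -/
theorem contactLineSkew_of_skew (h : CoefficientCut.NoSkewJointTailsDeep) : NoContactLineSkewTailsDeep :=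
  fun p hp e he K _ _ _ _ s₀ hs W hsh N hplat hexc hS hT hskew _ _ _ =>
    h p hp e he K s₀ hs W hsh N hplat hexc hS hT hskew

/-- THE LINE-FREE LOCATED RESIDUAL (rev 2) · **RIGID SKEW STALLED TAILS THAT NEVER ACQUIRE A CONTACT LINE** · the rigid
residual's binders VERBATIM + «for NO time `s` and NO functional `c` is `c` a contact line from `s`».  EXACT:
`NoRigidSkewStalledTailsDeep ↔` this (`rigid_iff_lineFree`, by the contact-line law).  Leaf: IDEA-NEEDED = NEXT-g21 §1
item 2 (produce the contact line from clean transport + the pure-power event: `CleanAt`, `initialForm_move_of_clean`,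
`translate_eq_homogeneousComponent_of_le_ordZero` are the typed inputs) ∧ INSTRUMENTABLE (longest carried-line run per
skew stalled stretch; interference events). [new] -/
def NoLineFreeRigidSkewStalledTailsDeep : Prop :=
  ∀ p : ℕ, p.Prime → ∀ e : ℕ, 2 ≤ e → ∀ (K : Type) [Field K] [CharP K p] [PerfectField K] [DecidableEq K]
    (s₀ : State (Fin 3) K), IsRoot (p ^ e) s₀ → ∀ W : ForcedWalk (p ^ e) s₀, (∀ i, 1 ≤ (W.st i).shade) →
    ∀ N : ℕ, (∀ t, N ≤ t → (W.st (t + 1)).shade = (W.st t).shade) →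
    (∀ t, N ≤ t → ordZero (W.st t).F ≠ ((p ^ e : ℕ) : ℕ∞)) →
    (∀ M : ℕ, ∃ t, M ≤ t ∧ StaysOnNewest W t) → (∀ M : ℕ, ∃ t, M ≤ t ∧ W.b t ≠ 0) →
    (∀ (k : Fin 3) (N' : ℕ), ∃ t, N' ≤ t ∧ (W.j t = k ∨ W.b t k ≠ 0)) →
    (∀ t, N ≤ t → (ifp W (t + 1)).muTilde (p ^ e) = (ifp W t).muTilde (p ^ e)) →
    (∀ t, N ≤ t → VertexLawEqAt W t) → (∀ t, N ≤ t → OriginLawAt W t) →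
    (∀ (s : ℕ) (c : Fin 3 → K), ¬ ContactLineFrom W s c) → False

/-- Trivial direction (binder dropped). [folklore] -/
theorem lineFree_of_rigid (h : NoRigidSkewStalledTailsDeep) : NoLineFreeRigidSkewStalledTailsDeep :=
  fun p hp e he K _ _ _ _ s₀ hs W hsh N hplat hexc hS hT hskew hstall hrig horig _ =>
    h p hp e he K s₀ hs W hsh N hplat hexc hS hT hskew hstall hrig horig

/-- **The contact-line law direction**: a rigid skew stalled tail either carries a contact line from some time on —
impossible by `planar_of_contactLine_of_repeats` against the skew binder — or is line-free. [folklore] -/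
theorem rigid_of_lineFree (h : NoLineFreeRigidSkewStalledTailsDeep) : NoRigidSkewStalledTailsDeep := by
  intro p hp e he K _ _ _ _ s₀ hs W hsh N hplat hexc hS hT hskew hstall hrig horig
  by_cases hline : ∃ (s : ℕ) (c : Fin 3 → K), ContactLineFrom W s c
  · obtain ⟨s, c, hc⟩ := hline
    exact false_of_skew_of_planar W hskew (planar_of_contactLine_of_repeats W hc hS)
  · push Not at hline
    exact h p hp e he K s₀ hs W hsh N hplat hexc hS hT hskew hstall hrig horig hline

/-- **EXACT re-location (rev 2):** the rigid residual IS its line-free part. [folklore] -/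
theorem rigid_iff_lineFree : NoRigidSkewStalledTailsDeep ↔ NoLineFreeRigidSkewStalledTailsDeep :=
  ⟨lineFree_of_rigid, rigid_of_lineFree⟩

/-- The g19 skew residual, re-located to the LINE-FREE RIGID class (EXACT, hypothesis-free). [folklore] -/
theorem skew_iff_lineFree : CoefficientCut.NoSkewJointTailsDeep ↔ NoLineFreeRigidSkewStalledTailsDeep :=
  skew_iff_rigid.trans rigid_iff_lineFree

end Classes

end Summit.ResolutionOfSingularities.ResolutionOfSingularities.Theorems.StallVertex
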